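import Literature.AnabelianGeometry.EtaleTheta.TemperedFrobenioidCnst
import Literature.AnabelianGeometry.EtaleTheta.TemperedFrobenioidToy
import Literature.AlgebraicGeometry.Frobenioids.ModelFrobenioidAutAction
import HarnessLib

/-!
# [EtTh] Theorem 3.7 (iii) — "the natural action of `Aut_C(A)` on `O^▷(A)`, `O^×(A)` factors through
# `Aut_{D^cnst}(A^cnst)`, faithfully for `Λ ∈ {ℤ, ℚ}`" — PROVED at the instantiated facade, modulo the
# Prop 3.4 (ii) naturality clauses

Proof-only companion (theorems only, no definitions) of `TemperedFrobenioidCnst.lean` (abc-iut-L2-t3,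
owner) in the series `Discharge/Sec3Thm37*.lean`.  S. Mochizuki, *The étale theta function …*, Publ. RIMS
**45** (2009) [EtTh], §3, Theorem 3.7 (iii), pp. 79–80 = PDF pp. 305–306 of
`paper:doi-10-2977-prims-1234361159` [cite: MochizukiEtTh2009, Thm 3.7 (iii) p.79]:

> "(iii) Let `A ∈ Ob(C)`; `A_D := Base(A) ∈ Ob(D)`. Write `A^cnst ∈ Ob(D^cnst)` for the image of `A_D`
> in `D^cnst` [cf. the discussion preceding Definition 3.3]. Then the natural action of `Aut_C(A)` on
> `O^▷(A)` and `O^×(A)` factors through `Aut_{D^cnst}(A^cnst)`. If, moreover, `Λ ∈ {ℤ, ℚ}`, then this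
> factorization determines a faithful action of the image of `Aut_C(A)` in `Aut_{D^cnst}(A^cnst)` on
> `O^▷(A)`, `O^×(A)`."  Proof (p.80): "Assertion (iii) follows immediately from Proposition 3.4, (ii)."

In the tree: the tempered Frobenioid IS the model Frobenioid of [FrdI] Thm. 5.2 (i) of the data
`(D, Φ, B, B → Φ^gp)` (`TemperedFrobenioid.category`), so a base-identity linear endomorphism is a
quadruple `f = (1, id, Div f, u_f)` with `u_f = (b, ξ) ∈ B(A_D) = B₀^Λ(Y_A) ×_{(Φ^{ℝ-log})^gp} Φ(A_D)^gp`,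
`ξ = Div_B(u_f) = [Div f]`, and its conjugate by `α ∈ Aut_C(A)` is
`(1, id, Base(α⁻¹)^*Div f, Base(α⁻¹)^*u_f)` (`ModelFrobenioid.div_conj'`, `unit_conj'`, abc-iut-L1; the
Frobenioid-side half `Discharge/Sec3Thm37AutAction.lean`, abc-iut-w4-d103).  The function component `b`
has EFFECTIVE divisor `[Div f] ∈ Φ(A_D) ⊆ Φ₀^ℝ(Y_A)`, so by Prop. 3.4 (ii) it is a constant
(`Prop34Cnst.mem_FΛ_of_divΛ_eq_of`: `b ∈ F₀^Λ(Y_A) ≅ (O_L^▷)^Λ`), on which — and on whose log-divisor —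
the pull-back action of `Aut_D(A_D) → Aut_{D₀}(Y_A)` is the action of the image in
`Aut_{D^cnst}(A^cnst)` (`Prop34Cnst.BΛ_map_eq_of_cnst_map_eq`, `ΦR_map_eq_of_cnst_map_eq`): first clause.
Second clause: every `b ∈ Ker(B₀^Λ(Y_A) → (Φ₀^ℝ)^gp)` is the function component of the unit
`(1, id, 0, (b, 0)) ∈ O^×(A)` (`ModelFrobenioid.unitAut`), so automorphisms conjugating `O^×(A)`
identically act identically on that kernel `≅ (O_L^×)^Λ`, hence (`Λ ∈ {ℤ, ℚ}`,
`Prop34Cnst.cnst_map_eq_of_BΛ_map_eq`) have the same image in `Aut_{D^cnst}(A^cnst)`.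

* `autActionFactorsThrough_of_prop34Cnst` / `autActionFaithful_of_prop34Cnst` — the two clauses as the
  real predicates `FrobenioidFacade.AutActionFactorsThrough` / `AutActionFaithful` over
  `K = (D → D₀) ⋙ cnst`;
* **`thm37_iii_withCnst`** — abc-iut-L2-t3's named `Prop` `TemperedFrobenioid.Thm37_iii` HOLDS at the
  instantiated facade `F.withCnst ((D → D₀) ⋙ cnst)` for EVERY facade `F` and every tempered Frobenioid
  whose Def. 3.6 (i) data satisfy `Prop34Cnst` (no `IsFrobenioid` / `hBmon` / divisoriality input);
* `autActionFactorsThrough_id` — over `K = 𝟭 D` the first predicate is the landed Frobenioid-side half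
  (consistency of the instantiation with sub-DAG row (iii)/L09);
* `Toy.prop34Cnst` — the hypothesis structure holds on the toy inhabitant of the interface stack
  (joint satisfiability), whence `Toy.thm37_iii`.
Cell bookkeeping: closes SUBDAG-EtTh-Thm37 rows (iii)/L10 `BaseActionThroughCnst`, (iii)/L11 `FaithfulZQ`
modulo the interface hypothesis `Prop34Cnst` (GAP-LEDGER G-w5d164-1).  HONEST FRAMING: refereed pre-IUT
material; nothing here bears on [IUTchIII] Cor. 3.12; no statement of the paper is strengthened.
-/

namespace Literature.AnabelianGeometry.EtaleTheta

open CategoryTheory Opposite Literature.AlgebraicGeometry.Frobenioids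

universe u₀ v₀ u₁ v₁ u v w

/-! ### Two corollaries of the hypothesis structure -/

namespace RealifiedDivisorMonoids.Prop34Cnst

variable {D₀ : Type u₀} [Category.{v₀} D₀] {V : FrdIMonoidStub.{w}}
  {T : RealifiedDivisorMonoids (D₀ := D₀) V} {Dcnst : Type u₁} [Category.{v₁} Dcnst]
  {cnst : D₀ ⥤ Dcnst}

/-- Isomorphism 1 in particular: `Ker(B₀^Λ(Y) → (Φ₀^ℝ)^gp(Y)) ⊆ F₀^Λ(Y)` ("`O_L^× ⥲ Ker(…) ⊆ B₀`",
with `O_L^× ⊆ L^× = F₀`). [cite: MochizukiEtTh2009, Prop 3.4 (ii) p.74] -/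
theorem mem_FΛ_of_divΛ_eq_one (P : T.Prop34Cnst cnst) (Y : D₀ᵒᵖ) {b : T.BΛ.obj Y}
    (hb : T.divΛ Y b = 1) : b ∈ T.FΛ Y :=
  P.mem_FΛ_of_divΛ_eq_of Y b 1 (by rw [hb, map_one])

/-- The pull-back action on the kernel `Ker(B₀^Λ(Y) → (Φ₀^ℝ)^gp(Y)) ≅ (O_L^×)^Λ` factors through
`D₀ → D^cnst`. [cite: MochizukiEtTh2009, Prop 3.4 (ii) p.74] -/
theorem BΛ_map_eq_of_divΛ_eq_one (P : T.Prop34Cnst cnst) {Y Y' : D₀} {g g' : Y ⟶ Y'}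
    (h : cnst.map g = cnst.map g') {b : T.BΛ.obj (op Y')} (hb : T.divΛ (op Y') b = 1) :
    (T.BΛ.map g.op).hom b = (T.BΛ.map g'.op).hom b :=
  P.BΛ_map_eq_of_cnst_map_eq g g' h b (P.mem_FΛ_of_divΛ_eq_one (op Y') hb)

end RealifiedDivisorMonoids.Prop34Cnst

namespace TemperedFrobenioid

variable {D₀ : Type u₀} [Category.{v₀} D₀] {V : FrdIMonoidStub.{w}}
  {T : RealifiedDivisorMonoids (D₀ := D₀) V} {D : Type u} [Category.{v} D]
  {VD : FrdICatStub.{u, v, w} D} (C₀ : TemperedFrobenioid T D VD)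
  {Dcnst : Type u₁} [Category.{v₁} Dcnst] {cnst : D₀ ⥤ Dcnst}

/-! ### The function component of a base-identity linear endomorphism is a constant -/

/-- For `f = (1, id, Div f, u_f) ∈ O^▷(A)`: `[Div f] = Div_B(u_f)` in `Φ(A_D)^gp` (the defining relation
of a morphism of the model Frobenioid at `deg_Fr = 1`, `Base = id`). [cite: MochizukiEtTh2009, Thm 3.7 (iii) p.79] -/
theorem of_div_eq_of_mem_endSubmonoid {A : C₀.category} {f : A ⟶ A}
    (hf : f ∈ PreFrobenioid.endSubmonoid C₀.toElem A) :
    Algebra.GrothendieckGroup.of (ModelFrobenioid.div f) =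
      (ModelFrobenioid.unit f : C₀.ratFn (op A.base)).1.2 := by
  have h := ModelFrobenioid.rel f
  have hb : ModelFrobenioid.baseMap f = 𝟙 A.base := hf.1
  have hd : ModelFrobenioid.degFr f = 1 := hf.2
  rw [hb, hd, PNat.one_coe, pow_one, pullGp_id] at h
  exact mul_left_cancel h

/-- For `f ∈ O^▷(A)` with `u_f = (b, ξ)`: the image of `b ∈ B₀^Λ(Y_A)` in `(Φ₀^ℝ)^gp(Y_A)` is the
EFFECTIVE element `Div f ∈ Φ(A_D) ⊆ Φ₀^ℝ(Y_A)`. [cite: MochizukiEtTh2009, Thm 3.7 (iii) p.79] -/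
theorem divΛ_unit_eq_of_div {A : C₀.category} {f : A ⟶ A}
    (hf : f ∈ PreFrobenioid.endSubmonoid C₀.toElem A) :
    T.divΛ (C₀.baseOp (op A.base)) (ModelFrobenioid.unit f : C₀.ratFn (op A.base)).1.1 =
      Algebra.GrothendieckGroup.of
        (ModelFrobenioid.div f : C₀.Φ.carrier (op A.base)).1 := by
  have hmem : T.divΛ (C₀.baseOp (op A.base)) (ModelFrobenioid.unit f : C₀.ratFn (op A.base)).1.1 =
      C₀.ΦgpToRlog (op A.base) (ModelFrobenioid.unit f : C₀.ratFn (op A.base)).1.2 :=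
    (ModelFrobenioid.unit f : C₀.ratFn (op A.base)).2
  rw [hmem, ← C₀.of_div_eq_of_mem_endSubmonoid hf]
  exact gpMap_of (C₀.Φ.carrier (op A.base)).subtype (ModelFrobenioid.div f)

/-- Hence `b` is a constant: `b ∈ F₀^Λ(Y_A)` (Prop. 3.4 (ii): `(O_L^▷)^Λ ⊆ F₀^Λ`).
[cite: MochizukiEtTh2009, Thm 3.7 (iii) p.80] -/
theorem unit_fst_mem_FΛ (P : T.Prop34Cnst cnst) {A : C₀.category} {f : A ⟶ A}
    (hf : f ∈ PreFrobenioid.endSubmonoid C₀.toElem A) :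
    (ModelFrobenioid.unit f : C₀.ratFn (op A.base)).1.1 ∈ T.FΛ (C₀.baseOp (op A.base)) :=
  P.mem_FΛ_of_divΛ_eq_of _ _ _ (C₀.divΛ_unit_eq_of_div hf)

/-! ### Automorphisms with the same image in `Aut_{D^cnst}(A^cnst)` -/

/-- Automorphisms `α, β` of `A` with the same image in `Aut_{D^cnst}(A^cnst)` have inverses with the same
image there. [cite: MochizukiEtTh2009, Thm 3.7 (iii) p.79] -/
theorem cnst_map_baseMap_inv_eq (cnst : D₀ ⥤ Dcnst) {A : C₀.category} {α β : A ≅ A}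
    (h : cnst.map (C₀.base.map (ModelFrobenioid.baseMap α.hom)) =
      cnst.map (C₀.base.map (ModelFrobenioid.baseMap β.hom))) :
    cnst.map (C₀.base.map (ModelFrobenioid.baseMap α.inv)) =
      cnst.map (C₀.base.map (ModelFrobenioid.baseMap β.inv)) := by
  have e : (C₀.cnstFunctor cnst).mapIso α = (C₀.cnstFunctor cnst).mapIso β := Iso.ext h
  exact congrArg Iso.inv e

/-- … and conversely. [cite: MochizukiEtTh2009, Thm 3.7 (iii) p.79] -/
theorem cnst_map_baseMap_hom_eq (cnst : D₀ ⥤ Dcnst) {A : C₀.category} {α β : A ≅ A}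
    (h : cnst.map (C₀.base.map (ModelFrobenioid.baseMap α.inv)) =
      cnst.map (C₀.base.map (ModelFrobenioid.baseMap β.inv))) :
    cnst.map (C₀.base.map (ModelFrobenioid.baseMap α.hom)) =
      cnst.map (C₀.base.map (ModelFrobenioid.baseMap β.hom)) := by
  have e : (C₀.cnstFunctor cnst).mapIso α.symm = (C₀.cnstFunctor cnst).mapIso β.symm := Iso.ext h
  exact congrArg Iso.inv e

/-! ### Theorem 3.7 (iii), first clause -/

/-- The divisor component: for `f ∈ O^▷(A)` and automorphisms `α, β` with the same image in
`Aut_{D^cnst}(A^cnst)`, `Base(α⁻¹)^* Div f = Base(β⁻¹)^* Div f` — the log-divisor of a constant is acted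
on through `D^cnst` (Prop. 3.4 (ii)). [cite: MochizukiEtTh2009, Thm 3.7 (iii) p.80] -/
theorem pull_div_eq_of_cnst_map_eq (P : T.Prop34Cnst cnst) {A : C₀.category} {α β : A ≅ A}
    (h : cnst.map (C₀.base.map (ModelFrobenioid.baseMap α.hom)) =
      cnst.map (C₀.base.map (ModelFrobenioid.baseMap β.hom)))
    {f : A ⟶ A} (hf : f ∈ PreFrobenioid.endSubmonoid C₀.toElem A) :
    pull C₀.divisorMonoid (ModelFrobenioid.baseMap α.inv) (ModelFrobenioid.div f) =
      pull C₀.divisorMonoid (ModelFrobenioid.baseMap β.inv) (ModelFrobenioid.div f) := by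
  apply Subtype.ext
  change (T.ΦR.map (C₀.base.map (ModelFrobenioid.baseMap α.inv)).op).hom
      (ModelFrobenioid.div f : C₀.Φ.carrier (op A.base)).1 =
    (T.ΦR.map (C₀.base.map (ModelFrobenioid.baseMap β.inv)).op).hom
      (ModelFrobenioid.div f : C₀.Φ.carrier (op A.base)).1
  exact P.ΦR_map_eq_of_cnst_map_eq _ _ (C₀.cnst_map_baseMap_inv_eq cnst h) _
    ⟨_, C₀.unit_fst_mem_FΛ P hf, C₀.divΛ_unit_eq_of_div hf⟩

/-- The unit component: `Base(α⁻¹)^* u_f = Base(β⁻¹)^* u_f` — the constant `b` is acted on through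
`D^cnst`, and the `Φ(A_D)^gp`-component `[Div f]` by the divisor component.
[cite: MochizukiEtTh2009, Thm 3.7 (iii) p.80] -/
theorem pull_unit_eq_of_cnst_map_eq (P : T.Prop34Cnst cnst) {A : C₀.category} {α β : A ≅ A}
    (h : cnst.map (C₀.base.map (ModelFrobenioid.baseMap α.hom)) =
      cnst.map (C₀.base.map (ModelFrobenioid.baseMap β.hom)))
    {f : A ⟶ A} (hf : f ∈ PreFrobenioid.endSubmonoid C₀.toElem A) :
    pull C₀.ratFnFunctor (ModelFrobenioid.baseMap α.inv) (ModelFrobenioid.unit f) =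
      pull C₀.ratFnFunctor (ModelFrobenioid.baseMap β.inv) (ModelFrobenioid.unit f) := by
  apply Subtype.ext
  refine Prod.ext ?_ ?_
  · change (T.BΛ.map (C₀.base.map (ModelFrobenioid.baseMap α.inv)).op).hom
        (ModelFrobenioid.unit f : C₀.ratFn (op A.base)).1.1 =
      (T.BΛ.map (C₀.base.map (ModelFrobenioid.baseMap β.inv)).op).hom
        (ModelFrobenioid.unit f : C₀.ratFn (op A.base)).1.1
    exact P.BΛ_map_eq_of_cnst_map_eq _ _ (C₀.cnst_map_baseMap_inv_eq cnst h) _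
      (C₀.unit_fst_mem_FΛ P hf)
  · change gpMap (C₀.Φ.pull (ModelFrobenioid.baseMap α.inv).op)
        (ModelFrobenioid.unit f : C₀.ratFn (op A.base)).1.2 =
      gpMap (C₀.Φ.pull (ModelFrobenioid.baseMap β.inv).op)
        (ModelFrobenioid.unit f : C₀.ratFn (op A.base)).1.2
    rw [← C₀.of_div_eq_of_mem_endSubmonoid hf]
    exact (gpMap_of (C₀.Φ.pull (ModelFrobenioid.baseMap α.inv).op) (ModelFrobenioid.div f)).trans
      ((congrArg Algebra.GrothendieckGroup.of (C₀.pull_div_eq_of_cnst_map_eq P h hf)).trans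
        (gpMap_of (C₀.Φ.pull (ModelFrobenioid.baseMap β.inv).op) (ModelFrobenioid.div f)).symm)

/-- **Theorem 3.7 (iii), first clause, on `O^▷(A)`**: automorphisms `α, β` of `A` with the same image in
`Aut_{D^cnst}(A^cnst)` conjugate every base-identity linear endomorphism identically.
[cite: MochizukiEtTh2009, Thm 3.7 (iii) p.79] -/
theorem conj_eq_conj_of_cnst_map_eq (P : T.Prop34Cnst cnst) {A : C₀.category} {α β : A ≅ A}
    (h : cnst.map (C₀.base.map (ModelFrobenioid.baseMap α.hom)) =
      cnst.map (C₀.base.map (ModelFrobenioid.baseMap β.hom)))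
    {f : A ⟶ A} (hf : f ∈ PreFrobenioid.endSubmonoid C₀.toElem A) :
    α.inv ≫ f ≫ α.hom = β.inv ≫ f ≫ β.hom := by
  have hfb : ModelFrobenioid.baseMap f = 𝟙 A.base := hf.1
  have hfd : ModelFrobenioid.degFr f = 1 := hf.2
  refine ModelFrobenioid.hom_ext ?_ ?_ ?_ ?_
  · rw [ModelFrobenioid.degFr_conj' α hfd, ModelFrobenioid.degFr_conj' β hfd]
  · rw [ModelFrobenioid.baseMap_conj' α hfb, ModelFrobenioid.baseMap_conj' β hfb]
  · rw [ModelFrobenioid.div_conj' α hfb hfd, ModelFrobenioid.div_conj' β hfb hfd]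
    exact C₀.pull_div_eq_of_cnst_map_eq P h hf
  · rw [ModelFrobenioid.unit_conj' α hfb hfd, ModelFrobenioid.unit_conj' β hfb hfd]
    exact C₀.pull_unit_eq_of_cnst_map_eq P h hf

/-- **Theorem 3.7 (iii), first clause** (p.79) as the real predicate
`FrobenioidFacade.AutActionFactorsThrough ((D → D₀) ⋙ cnst)`: "the natural action of `Aut_C(A)` on
`O^▷(A)` and `O^×(A)` factors through `Aut_{D^cnst}(A^cnst)`", for every tempered Frobenioid whose
Def. 3.6 (i) data satisfy the Prop. 3.4 (ii) clauses `Prop34Cnst`. [cite: MochizukiEtTh2009, Thm 3.7 (iii) p.79] -/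
theorem autActionFactorsThrough_of_prop34Cnst (P : T.Prop34Cnst cnst) (A : C₀.category) :
    FrobenioidFacade.AutActionFactorsThrough (C₀.base ⋙ cnst) C₀.toElem A := by
  intro α β h
  refine ⟨fun f hf => C₀.conj_eq_conj_of_cnst_map_eq P h hf, fun u hu => ?_⟩
  apply Iso.ext
  change α.inv ≫ u.hom ≫ α.hom = β.inv ≫ u.hom ≫ β.hom
  exact C₀.conj_eq_conj_of_cnst_map_eq P h ⟨hu.1, hu.2⟩

/-! ### Theorem 3.7 (iii), second clause -/

/-- Every element `b` of `Ker(B₀^Λ(Y_A) → (Φ₀^ℝ)^gp(Y_A))` is the function component of a unit of `A`: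
the automorphism `(1, id, 0, (b, 0)) ∈ O^×(A)` (`B₀^Λ(Y_A)` group-like, Def. 3.6 (i)).
[cite: MochizukiEtTh2009, Thm 3.7 (iii) p.80] -/
theorem exists_units_unit_fst_eq (A : C₀.category) (b : T.BΛ.obj (C₀.baseOp (op A.base)))
    (hb : T.divΛ (C₀.baseOp (op A.base)) b = 1) :
    ∃ u : A ≅ A, u ∈ PreFrobenioid.unitsSubgroup C₀.toElem A ∧
      (ModelFrobenioid.unit u.hom : C₀.ratFn (op A.base)).1.1 = b := by
  obtain ⟨bu, rfl⟩ := T.isUnit_BΛ _ b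
  have hb' : T.divΛ (C₀.baseOp (op A.base)) ↑bu⁻¹ = 1 := by
    have hmul : T.divΛ (C₀.baseOp (op A.base)) ↑bu⁻¹ * T.divΛ (C₀.baseOp (op A.base)) ↑bu = 1 := by
      rw [← map_mul, Units.inv_mul, map_one]
    rwa [hb, mul_one] at hmul
  let p : C₀.ratFn (op A.base) := ⟨((bu : T.BΛ.obj _), 1), by
    change T.divΛ (C₀.baseOp (op A.base)) ↑bu = C₀.ΦgpToRlog (op A.base) 1
    rw [hb, map_one]⟩
  let p' : C₀.ratFn (op A.base) := ⟨((↑bu⁻¹ : T.BΛ.obj _), 1), by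
    change T.divΛ (C₀.baseOp (op A.base)) ↑bu⁻¹ = C₀.ΦgpToRlog (op A.base) 1
    rw [hb', map_one]⟩
  have h1 : Algebra.GrothendieckGroup.of (1 : C₀.divisorMonoid.obj (op A.base)) =
      Literature.AlgebraicGeometry.Frobenioids.divB C₀.divisorMonoid C₀.ratFnFunctor C₀.divBNatTrans (op A.base) p := by
    rw [map_one]; rfl
  have h1' : Algebra.GrothendieckGroup.of (1 : C₀.divisorMonoid.obj (op A.base)) =
      Literature.AlgebraicGeometry.Frobenioids.divB C₀.divisorMonoid C₀.ratFnFunctor C₀.divBNatTrans (op A.base) p' := by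
    rw [map_one]; rfl
  have hpp : p' * p = 1 := Subtype.ext (Prod.ext (Units.inv_mul bu) (one_mul 1))
  refine ⟨ModelFrobenioid.unitAut A 1 1 (p : C₀.ratFnFunctor.obj (op A.base)) p' h1 h1' (mul_one 1) hpp,
    ModelFrobenioid.unitAut_mem_units A 1 1 _ _ h1 h1' (mul_one 1) hpp, rfl⟩

/-- Automorphisms conjugating `O^×(A)` identically act identically, through `Base(−)⁻¹` and `D → D₀`,
on `Ker(B₀^Λ(Y_A) → (Φ₀^ℝ)^gp(Y_A)) ≅ (O_L^×)^Λ`. [cite: MochizukiEtTh2009, Thm 3.7 (iii) p.80] -/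
theorem BΛ_map_eq_of_conj_units_eq {A : C₀.category} {α β : A ≅ A}
    (hαβ : ∀ u ∈ PreFrobenioid.unitsSubgroup C₀.toElem A, α.symm ≪≫ u ≪≫ α = β.symm ≪≫ u ≪≫ β)
    (b : T.BΛ.obj (C₀.baseOp (op A.base))) (hb : T.divΛ (C₀.baseOp (op A.base)) b = 1) :
    (T.BΛ.map (C₀.base.map (ModelFrobenioid.baseMap α.inv)).op).hom b =
      (T.BΛ.map (C₀.base.map (ModelFrobenioid.baseMap β.inv)).op).hom b := by
  obtain ⟨u, hu, hub⟩ := C₀.exists_units_unit_fst_eq A b hb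
  have hfb : ModelFrobenioid.baseMap u.hom = 𝟙 A.base := hu.1
  have hfd : ModelFrobenioid.degFr u.hom = 1 := hu.2
  have hconj : α.inv ≫ u.hom ≫ α.hom = β.inv ≫ u.hom ≫ β.hom := congrArg Iso.hom (hαβ u hu)
  have hunit := congrArg ModelFrobenioid.unit hconj
  rw [ModelFrobenioid.unit_conj' α hfb hfd, ModelFrobenioid.unit_conj' β hfb hfd] at hunit
  have hcoe : (T.BΛ.map (C₀.base.map (ModelFrobenioid.baseMap α.inv)).op).hom
        (ModelFrobenioid.unit u.hom : C₀.ratFn (op A.base)).1.1 =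
      (T.BΛ.map (C₀.base.map (ModelFrobenioid.baseMap β.inv)).op).hom
        (ModelFrobenioid.unit u.hom : C₀.ratFn (op A.base)).1.1 :=
    congrArg (fun q : C₀.ratFnFunctor.obj (op A.base) => (q : C₀.ratFn (op A.base)).1.1) hunit
  rw [← hub]
  exact hcoe

/-- **Theorem 3.7 (iii), second clause** (p.80) as the real predicate
`FrobenioidFacade.AutActionFaithful ((D → D₀) ⋙ cnst)`: for `Λ ∈ {ℤ, ℚ}`, automorphisms of `A`
conjugating `O^×(A)` identically have the same image in `Aut_{D^cnst}(A^cnst)` — "this factorization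
determines a faithful action of the image of `Aut_C(A)` in `Aut_{D^cnst}(A^cnst)`".
[cite: MochizukiEtTh2009, Thm 3.7 (iii) p.80] -/
theorem autActionFaithful_of_prop34Cnst (P : T.Prop34Cnst cnst)
    (hΛ : C₀.monoidType = MonoidType.Z ∨ C₀.monoidType = MonoidType.Q) (A : C₀.category) :
    FrobenioidFacade.AutActionFaithful (C₀.base ⋙ cnst) C₀.toElem A := by
  intro α β hαβ
  have hinv := P.cnst_map_eq_of_BΛ_map_eq hΛ
    ((C₀.baseFunctorOfCategory ⋙ C₀.base).mapIso α).symm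
    ((C₀.baseFunctorOfCategory ⋙ C₀.base).mapIso β).symm
    (fun b hb => C₀.BΛ_map_eq_of_conj_units_eq hαβ b hb)
  exact C₀.cnst_map_baseMap_hom_eq cnst hinv

/-! ### Theorem 3.7 (iii) at the instantiated facade -/

/-- **Theorem 3.7 (iii)** (pp.79–80) — abc-iut-L2-t3's named `Prop` `TemperedFrobenioid.Thm37_iii` HOLDS
at the facade whose Thm. 3.7 (iii) fields are instantiated over the constant-field functor
`(D → D₀) ⋙ cnst` (`FrobenioidFacade.withCnst`), for every facade `F` and every tempered Frobenioid whose
Def. 3.6 (i) data satisfy the Prop. 3.4 (ii) clauses `Prop34Cnst` — print: "Assertion (iii) follows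
immediately from Proposition 3.4, (ii)." [cite: MochizukiEtTh2009, Thm 3.7 (iii) p.79] -/
theorem thm37_iii_withCnst (F : FrobenioidFacade.{u, v, w} D) (P : T.Prop34Cnst cnst) :
    C₀.Thm37_iii (F.withCnst (C₀.base ⋙ cnst)) :=
  ⟨fun A => C₀.autActionFactorsThrough_of_prop34Cnst P A,
    fun hΛ A => C₀.autActionFaithful_of_prop34Cnst P hΛ A⟩

/-- Consistency with the Frobenioid-side half (sub-DAG row (iii)/L09, `Sec3Thm37AutAction.lean`): over
`K = 𝟭 D` ("same image in `Aut_D(A_D)`") the first predicate holds for EVERY tempered Frobenioid,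
unconditionally. [cite: MochizukiEtTh2009, Thm 3.7 (iii) p.79] -/
theorem autActionFactorsThrough_id (A : C₀.category) :
    FrobenioidFacade.AutActionFactorsThrough (𝟭 D) C₀.toElem A :=
  fun α β h => ModelFrobenioid.autAction_factorsThroughBase A α β h

end TemperedFrobenioid

/-! ### Consistency witness: the toy inhabitant of the interface stack satisfies `Prop34Cnst` -/

namespace Toy

/-- Over the degenerate inhabitant `Toy.realified` of the Def. 3.3 (iii) / 3.6 (i) interfaces (one-object
base category, all functions constant), `Prop34Cnst` holds for `D^cnst := D₀`, `cnst := 𝟭`: the new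
hypothesis structure is jointly satisfiable with the rest of the stack. [cite: MochizukiEtTh2009, Prop 3.4 (ii) p.74] -/
theorem prop34Cnst : realified.Prop34Cnst (𝟭 (Discrete PUnit.{1})) where
  mem_FΛ_of_divΛ_eq_of _ _ _ _ := trivial
  BΛ_map_eq_of_cnst_map_eq g g' _ _ _ := by rw [Subsingleton.elim g g']
  ΦR_map_eq_of_cnst_map_eq g g' _ _ _ := by rw [Subsingleton.elim g g']
  cnst_map_eq_of_BΛ_map_eq _ _ g g' _ := Subsingleton.elim _ _

/-- Hence Theorem 3.7 (iii), as typed, holds for the toy tempered Frobenioid at the instantiated facade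
(any `F`). [cite: MochizukiEtTh2009, Thm 3.7 (iii) p.79] -/
theorem thm37_iii (F : FrobenioidFacade.{0, 0, 0} (Discrete PUnit.{1})) :
    temperedFrobenioid.Thm37_iii (F.withCnst (temperedFrobenioid.base ⋙ 𝟭 (Discrete PUnit.{1}))) :=
  temperedFrobenioid.thm37_iii_withCnst F prop34Cnst

end Toy

end Literature.AnabelianGeometry.EtaleTheta
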